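import Summits.QuantumFields.YangMills.Theorems.UnitScaleTiltProp8FlatCubeOpsText
import HarnessLib

/-!
# Route `UnitScaleTilt`, crux K1 child «MinimiserStabilityRegPr» (stmt-QuantumFields-19200), v8 pillar P2 — **THE ONE-LEVEL INSTANCE OF THE P2 TEXT IS ADMISSIBLE
# WITH TRIVIAL WEIGHTS**: for the all-torus family `Domains.whole k` ([Balaban1984PropagatorsII] p. 224 «Ω_j = T_η for j = 1, …, l» with `l = k`; the pure small-field /
# small-torus case of UV3-NODE §24.2, p1 g14's one-level menu) the admissibility `FlatCubeOpsText.Adm22` holds for EVERY `R, M`, every fine site has level `k`, and the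
# P2 weights `(L^{j(b)}η)^m` are identically `1` at the carrier (`L^kη = 1`) — so `FlatOpsAdm(Pow)At` read at `D := Domains.whole (K−n)` is exactly the UNWEIGHTED one-level
# letter set (p1 g14's `FlatPropagator*`/`FlatMinimizerH*`, p525977, F4's `letters_G_sub_HQG`), modulo the identification of r03's `twoScale (K−n) … ∅` operators (k = K−n+1,
# empty top) with those of `whole (K−n)` (successor step, UV3-NODE §24.7)

Cell `ym3-torus` (HUMAN RULING D-0037, YM ladder rung R3), seat `ym3-torus-p1` gen 15.  `--supports stmt-QuantumFields-19200 --as helper`; count-neutral; def-free.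

WHAT IS PROVED (sorry-free; axioms standard): `whole_Om_of_le` / `whole_Om_of_lt`, `inOm_whole_iff`, **`adm22_whole`** (`Adm22 (Domains.whole k hk) R M` for all `R M`),
**`levOf_whole`** (`levOf (j ↦ {x | (whole k hk).InOm j x}) k x = k`), **`levWeight_whole_eq_one`** (`IsLevWeight F n K (whole (K−n) _) w → w m b = 1`).
HONEST SCOPE: bookkeeping; NOT a claim about the mass gap.

References: [Balaban1984PropagatorsII] (2.1) p.224 («Ω_j = T_η for j = 1, …, l»); [Balaban1985Variational] (5)–(6) p.278 (the pure small-field problem), p.286.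
-/

set_option autoImplicit false

namespace Summit.QuantumFields.YangMills.Theorems.FlatCubeOpsTextWhole

open Literature.MathematicalPhysics.QuantumFieldTheory.Balaban1983to89
open B6SectADomainsV1 (Domains)
open B5Eq117TorusCarriers (Mk)
open B5Eq118OneStroke (iterBlockOf)
open B5Prop12FieldsLattice (distSite)
open B11Eq115Space (levOf)
open T3ContinuumYM3Torus (T3Family)
open FlatCubeOpsText (Adm22 IsLevWeight)
open FlatCubeLevels (levOf_inOm_eq_top_iff)

variable {P : Params}

/-- the all-torus family: `Ω_j^{(j)} = T^{(j)}` for `j ≤ k`. [cite: Balaban1984PropagatorsII, (2.1) p.224] -/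
theorem whole_Om_of_le {k : ℕ} (hk : k ≤ P.m + P.K) {j : ℕ} (hj : j ≤ k) : (Domains.whole k hk : Domains P).Om j = Finset.univ := by
  simp [Domains.whole, hj]

/-- the all-torus family: no domain beyond `k`. [cite: Balaban1984PropagatorsII, (2.1) p.224] -/
theorem whole_Om_of_lt {k : ℕ} (hk : k ≤ P.m + P.K) {j : ℕ} (hj : k < j) : (Domains.whole k hk : Domains P).Om j = ∅ := by
  simp [Domains.whole, not_le.mpr hj]

/-- membership in the all-torus family is `j ≤ k`. [cite: Balaban1984PropagatorsII, (2.1) p.224] -/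
theorem inOm_whole_iff {k : ℕ} (hk : k ≤ P.m + P.K) (j : ℕ) (x : Site P 0) : (Domains.whole k hk : Domains P).InOm j x ↔ j ≤ k := by
  unfold Domains.InOm
  by_cases hj : j ≤ k
  · simp [whole_Om_of_le hk hj, hj]
  · simp [whole_Om_of_lt hk (not_le.mp hj), hj]

/-- **THE ONE-LEVEL FAMILY IS ADMISSIBLE FOR EVERY `R`, `M`**: both clauses of `Adm22` are void or trivial when every positive-level domain is the whole torus.
[cite: Balaban1984PropagatorsII, (2.1)-(2.2) p.224 («we admit the case when some domains Ω_j are equal to T_η»)] -/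
theorem adm22_whole {k : ℕ} (hk : k ≤ P.m + P.K) (R M : ℕ) : Adm22 (Domains.whole k hk : Domains P) R M := by
  refine ⟨fun j _ y y' _ => ?_, fun j y y' hy hy' => ?_⟩
  · by_cases hjk : j ≤ k
    · simp [whole_Om_of_le hk hjk]
    · simp [whole_Om_of_lt hk (not_le.mp hjk)]
  · exfalso
    by_cases hjk : j + 1 ≤ k
    · exact hy' (by rw [whole_Om_of_le hk (by omega)]; exact Finset.mem_univ _)
    · rw [whole_Om_of_lt hk (by omega)] at hy
      simp at hy

/-- **EVERY FINE SITE IS AT THE TOP LEVEL** in the all-torus family: `levOf (j ↦ {x | x ∈ Bʲ(Ω_j^{(j)})}) k x = k`. [cite: Balaban1985Variational, p.286] -/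
theorem levOf_whole {k : ℕ} (hk : k ≤ P.m + P.K) (x : Site P 0) :
    levOf (fun j => {y : Site P 0 | (Domains.whole k hk : Domains P).InOm j y}) k x = k := by
  have hkk : (Domains.whole k hk : Domains P).k = k := rfl
  have h := (levOf_inOm_eq_top_iff (Domains.whole k hk : Domains P) x).2 (by rw [hkk]; exact (inOm_whole_iff hk k x).2 le_rfl)
  rw [hkk] at h
  exact h

section T3

/-- **THE P2 WEIGHTS ARE IDENTICALLY `1` ON THE ONE-LEVEL FAMILY AT THE CARRIER** (`(L^{K−n}η)^m = 1`, `η = L^{−(K−n)}`): `FlatOpsAdm(Pow)At` read at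
`D := Domains.whole (K−n)` is the UNWEIGHTED letter set of the pure small-field problem. [cite: Balaban1985Variational, (5)-(6) p.278, p.286] -/
theorem levWeight_whole_eq_one (F : T3Family) (n K : ℕ) (hk : K - n ≤ (F.P K).m + (F.P K).K) (w : ℕ → PBond (F.P K) 0 → ℝ)
    (hw : IsLevWeight F n K (Domains.whole (K - n) hk) w) (m : ℕ) (b : PBond (F.P K) 0) : w m b = 1 := by
  have hL : (F.L : ℝ) ≠ 0 := by exact_mod_cast (lt_trans zero_lt_one F.hL.2).ne'
  rw [hw m b]
  have hlev : levOf (fun j => {y : Site (F.P K) 0 | (Domains.whole (K - n) hk : Domains (F.P K)).InOm j y}) (K - n) b.src = K - n :=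
    levOf_whole hk b.src
  rw [show levOf (fun j => {x : Site (F.P K) 0 | (Domains.whole (K - n) hk : Domains (F.P K)).InOm j x}) (K - n) b.src = K - n from hlev,
    inv_pow, mul_inv_cancel₀ (pow_ne_zero _ hL), one_pow]

end T3

end Summit.QuantumFields.YangMills.Theorems.FlatCubeOpsTextWhole
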